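import Summits.ResolutionOfSingularities.ResolutionOfSingularities.Theorems.EigenLadderLU
import HarnessLib

/-!
# EigenLadderLU1B — decomp-res node «EigenLadder» (lens-1 g24, CRITIC-LEDGER row 187 CLEARED
DECIDED-MOD-D +1 · MAP 0): continuation of `EigenLadderLU`

PART C1 — invariants of a diagonal tame action on a rational function field lie in the field of
invariant Laurent monomials (`lmon`, `pow_sigma_prod_pow`, `isoPart`, `reynolds_aeval`,
`mem_of_fixed`): isotypic decomposition of polynomials under the character grading; hypothesis-free
kernel algebra (no THEOREM D, no port).

[WRITER NOTE (decomp-res writer g12): the gate caps Theorems files with proofs at 400 lines, so the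
lens's tree file `EigenLadderLU.lean` (470 l, sha256 2160ec60…) is landed as TWO modules split at a
namespace-block boundary — `EigenLadderLU` (PART A twisted Reynolds operators) and `EigenLadderLU1B`
(PART C1 invariants of a diagonal tame action) — content VERBATIM (plus bookkeeping docstrings on
undocumented simp lemmas); the node's import chain becomes EigenLadderLU → EigenLadderLU1B →
EigenLadderLU2 → EigenLadderLU2B → EigenLadderLU3 → EigenLadderLU4 → EigenLadderLU5 →
EigenLadderLU5B → EigenLadderLU6 (one namespace `…Theorems.EigenLadderLU` throughout).]
-/

namespace Summit.ResolutionOfSingularities.ResolutionOfSingularities.Theorems.EigenLadderLU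

/-! ## PART C1 — invariants of a diagonal tame action on a rational function field lie in the field of
invariant Laurent monomials (character lattice `M = {a : ℓ ∣ Σ aⱼ tⱼ}`) -/

section Invariants

variable {k : Type} [Field k] {L : Type} [Field L] [Algebra k L]
variable {ι : Type} [Fintype ι]

/-- Laurent monomial `x^b = ∏ⱼ xⱼ^{bⱼ}`, `b ∈ ℤ^ι`. [folklore] -/
def lmon (x : ι → L) (b : ι → ℤ) : L := ∏ j, x j ^ b j

/-- `lmon_def`: Bookkeeping / simp lemma of the eigen-ladder kernel (decomp-res lens-1 g24 «EigenLadder»),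
VERBATIM from the lens's tree file (see the module docstring); the statement is its type. [folklore] -/
theorem lmon_def (x : ι → L) (b : ι → ℤ) : lmon x b = ∏ j, x j ^ b j := rfl

/-- `lmon_ne_zero`: Bookkeeping / simp lemma of the eigen-ladder kernel (decomp-res lens-1 g24 «EigenLadder»),
VERBATIM from the lens's tree file (see the module docstring); the statement is its type. [folklore] -/
theorem lmon_ne_zero (x : ι → L) (hx0 : ∀ j, x j ≠ 0) (b : ι → ℤ) : lmon x b ≠ 0 :=
  Finset.prod_ne_zero_iff.mpr fun j _ => zpow_ne_zero _ (hx0 j)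

/-- `lmon_zero`: Bookkeeping / simp lemma of the eigen-ladder kernel (decomp-res lens-1 g24 «EigenLadder»),
VERBATIM from the lens's tree file (see the module docstring); the statement is its type. [folklore] -/
theorem lmon_zero (x : ι → L) : lmon x 0 = 1 := by simp [lmon_def]

/-- `lmon_add`: Bookkeeping / simp lemma of the eigen-ladder kernel (decomp-res lens-1 g24 «EigenLadder»),
VERBATIM from the lens's tree file (see the module docstring); the statement is its type. [folklore] -/
theorem lmon_add (x : ι → L) (hx0 : ∀ j, x j ≠ 0) (b c : ι → ℤ) :
    lmon x (b + c) = lmon x b * lmon x c := by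
  rw [lmon_def, lmon_def, lmon_def, ← Finset.prod_mul_distrib]
  exact Finset.prod_congr rfl fun j _ => by rw [Pi.add_apply, zpow_add₀ (hx0 j)]

/-- `lmon_zsmul`: Bookkeeping / simp lemma of the eigen-ladder kernel (decomp-res lens-1 g24 «EigenLadder»),
VERBATIM from the lens's tree file (see the module docstring); the statement is its type. [folklore] -/
theorem lmon_zsmul (x : ι → L) (_hx0 : ∀ j, x j ≠ 0) (n : ℤ) (b : ι → ℤ) :
    lmon x (n • b) = lmon x b ^ n := by
  rw [lmon_def, lmon_def, ← Finset.prod_zpow]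
  exact Finset.prod_congr rfl fun j _ => by rw [Pi.smul_apply, smul_eq_mul, mul_comm, zpow_mul]

/-- `lmon_sub`: Bookkeeping / simp lemma of the eigen-ladder kernel (decomp-res lens-1 g24 «EigenLadder»),
VERBATIM from the lens's tree file (see the module docstring); the statement is its type. [folklore] -/
theorem lmon_sub (x : ι → L) (hx0 : ∀ j, x j ≠ 0) (b c : ι → ℤ) :
    lmon x (b - c) = lmon x b * (lmon x c)⁻¹ := by
  rw [sub_eq_add_neg, lmon_add x hx0, ← neg_one_zsmul, lmon_zsmul x hx0, zpow_neg_one]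

/-- `lmon_sum_zsmul`: Bookkeeping / simp lemma of the eigen-ladder kernel (decomp-res lens-1 g24
«EigenLadder»), VERBATIM from the lens's tree file (see the module docstring); the statement is its type. [folklore] -/
theorem lmon_sum_zsmul (x : ι → L) (hx0 : ∀ j, x j ≠ 0) {κ : Type} (s : Finset κ) (m : κ → ℤ)
    (b : κ → ι → ℤ) : lmon x (∑ i ∈ s, m i • b i) = ∏ i ∈ s, lmon x (b i) ^ m i := by
  classical
  induction s using Finset.induction_on with
  | empty => simp [lmon_zero]
  | insert a s ha ih => rw [Finset.sum_insert ha, Finset.prod_insert ha, lmon_add x hx0, lmon_zsmul x hx0, ih]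

/-- A Laurent monomial with non-negative exponents is an honest monomial. [folklore] -/
theorem lmon_natCast (x : ι → L) (B : ι → ℕ) :
    lmon x (fun j => (B j : ℤ)) = ∏ j, x j ^ B j := by
  rw [lmon_def]
  exact Finset.prod_congr rfl fun j _ => zpow_natCast _ _

/-- Laurent monomials in elements of a subfield lie in the subfield. [folklore] -/
theorem lmon_mem (x : ι → L) (F : Subfield L) (hx : ∀ j, x j ∈ F) (b : ι → ℤ) : lmon x b ∈ F :=
  Subfield.prod_mem _ fun j _ => Subfield.zpow_mem _ (hx j) _

omit [Fintype ι] in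
/-- `∏ⱼ ζ^{eⱼ} = ζ^{Σ eⱼ}` for a non-zero field element. [folklore] -/
theorem prod_zpow_eq_zpow_sum {ζ : k} (hζ0 : ζ ≠ 0) (s : Finset ι) (e : ι → ℤ) :
    ∏ j ∈ s, ζ ^ e j = ζ ^ ∑ j ∈ s, e j := by
  classical
  induction s using Finset.induction_on with
  | empty => simp
  | insert a s ha ih => rw [Finset.prod_insert ha, Finset.sum_insert ha, zpow_add₀ hζ0, ih]

/-- The **character** of a Laurent monomial under a diagonal action: `σ x^b = ζ^{⟨b,t⟩} x^b`. [folklore] -/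
theorem sigma_lmon (σ : L ≃ₐ[k] L) (x : ι → L) (_hx0 : ∀ j, x j ≠ 0) {ζ : k} (hζ0 : ζ ≠ 0)
    (t : ι → ℕ) (heig : ∀ j, σ (x j) = algebraMap k L (ζ ^ t j) * x j) (b : ι → ℤ) :
    σ (lmon x b) = algebraMap k L (ζ ^ ∑ j, b j * (t j : ℤ)) * lmon x b := by
  rw [lmon_def, map_prod, ← prod_zpow_eq_zpow_sum hζ0, map_prod, ← Finset.prod_mul_distrib]
  refine Finset.prod_congr rfl fun j _ => ?_
  rw [map_zpow₀, heig j, mul_zpow, ← map_zpow₀, ← zpow_natCast, ← zpow_mul, mul_comm (t j : ℤ)]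

/-- Invariance of the monomials of the character lattice `M = {b : ℓ ∣ ⟨b,t⟩}`. [folklore] -/
theorem sigma_lmon_of_dvd (σ : L ≃ₐ[k] L) (x : ι → L) (hx0 : ∀ j, x j ≠ 0) {ζ : k} {ℓ : ℕ}
    (hζ : IsPrimitiveRoot ζ ℓ) (hℓ : 0 < ℓ) (t : ι → ℕ)
    (heig : ∀ j, σ (x j) = algebraMap k L (ζ ^ t j) * x j) (b : ι → ℤ)
    (hb : (ℓ : ℤ) ∣ ∑ j, b j * (t j : ℤ)) : σ (lmon x b) = lmon x b := by
  rw [sigma_lmon σ x hx0 (hζ.ne_zero hℓ.ne') t heig, (hζ.zpow_eq_one_iff_dvd _).mpr hb, map_one,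
    one_mul]

/-- Iterates of a diagonal action on an honest monomial: `σⁱ x^a = ζ^{i·wt a} x^a`. [folklore] -/
theorem pow_sigma_prod_pow (σ : L ≃ₐ[k] L) (x : ι → L) {ζ : k} (t : ι → ℕ)
    (heig : ∀ j, σ (x j) = algebraMap k L (ζ ^ t j) * x j) (a : ι →₀ ℕ) (i : ℕ) :
    (σ ^ i) (∏ j, x j ^ a j) = algebraMap k L (ζ ^ (i * ∑ j, a j * t j)) * ∏ j, x j ^ a j := by
  induction i with
  | zero => simp
  | succ i ih =>
    rw [pow_succ_apply, ih, map_mul, AlgEquiv.commutes, map_prod]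
    have hj : ∀ j, σ (x j ^ a j) = algebraMap k L (ζ ^ (t j * a j)) * x j ^ a j := fun j => by
      rw [map_pow, heig, mul_pow, ← map_pow, ← pow_mul]
    simp only [hj]
    rw [Finset.prod_mul_distrib, ← map_prod, ← mul_assoc, ← map_mul]
    congr 2
    rw [Finset.prod_pow_eq_pow_sum, ← pow_add]
    congr 1
    rw [add_mul, one_mul]
    congr 1
    exact Finset.sum_congr rfl fun j _ => mul_comm _ _

/-- Exponent sums of a primitive root: `∑_{i<ℓ} ζ^{i n} = ℓ` if `ℓ ∣ n`, else `0`. [folklore] -/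
theorem sum_pow_mul_eq_ite {ζ : k} {ℓ : ℕ} (hζ : IsPrimitiveRoot ζ ℓ) (_hℓ : 0 < ℓ) (n : ℕ) :
    ∑ i ∈ Finset.range ℓ, ζ ^ (i * n) = if ℓ ∣ n then (ℓ : k) else 0 := by
  split_ifs with hdvd
  · obtain ⟨c, rfl⟩ := hdvd
    have : ∀ i ∈ Finset.range ℓ, ζ ^ (i * (ℓ * c)) = 1 := fun i _ => by
      rw [mul_left_comm, pow_mul, hζ.pow_eq_one, one_pow]
    rw [Finset.sum_congr rfl this]
    simp
  · have hne : ζ ^ n ≠ 1 := fun h => hdvd ((hζ.pow_eq_one_iff_dvd n).mp h)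
    have h1 : (∑ i ∈ Finset.range ℓ, (ζ ^ n) ^ i) * (ζ ^ n - 1) = 0 := by
      rw [geom_sum_mul, ← pow_mul, mul_comm, pow_mul, hζ.pow_eq_one, one_pow, sub_self]
    have h2 : ∑ i ∈ Finset.range ℓ, (ζ ^ n) ^ i = 0 :=
      (mul_eq_zero.mp h1).resolve_right (sub_ne_zero.mpr hne)
    rw [← h2]
    exact Finset.sum_congr rfl fun i _ => by rw [← pow_mul, mul_comm]

/-- `ζ′ := ζ^{ℓ-1}` is the inverse root: `ζ ζ′ = 1`. [folklore] -/
theorem mul_pow_pred_eq_one {ζ : k} {ℓ : ℕ} (hζ : IsPrimitiveRoot ζ ℓ) (hℓ : 0 < ℓ) :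
    ζ * ζ ^ (ℓ - 1) = 1 := by
  rw [← pow_succ', Nat.sub_add_cancel hℓ, hζ.pow_eq_one]

/-- The Reynolds operator is additive. [folklore] -/
theorem reynolds_add (σ : L ≃ₐ[k] L) (ζ' : k) (ℓ t : ℕ) (y z : L) :
    reynolds σ ζ' ℓ t (y + z) = reynolds σ ζ' ℓ t y + reynolds σ ζ' ℓ t z := by
  simp only [reynolds_def, map_add, mul_add, Finset.sum_add_distrib]

/-- The Reynolds operator is additive over finite sums. [folklore] -/
theorem reynolds_sum (σ : L ≃ₐ[k] L) (ζ' : k) (ℓ t : ℕ) {κ : Type} (s : Finset κ) (f : κ → L) :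
    reynolds σ ζ' ℓ t (∑ a ∈ s, f a) = ∑ a ∈ s, reynolds σ ζ' ℓ t (f a) := by
  classical
  induction s using Finset.induction_on with
  | empty => simp [reynolds_def]
  | insert a s ha ih => rw [Finset.sum_insert ha, Finset.sum_insert ha, reynolds_add, ih]

/-- `σ`-fixed factors pass through the Reynolds operator. [folklore] -/
theorem reynolds_mul_of_fixed (σ : L ≃ₐ[k] L) (ζ' : k) (ℓ t : ℕ) {z : L} (hz : σ z = z) (y : L) :
    reynolds σ ζ' ℓ t (z * y) = z * reynolds σ ζ' ℓ t y := by
  have hzi : ∀ i : ℕ, (σ ^ i) z = z := by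
    intro i
    induction i with
    | zero => simp
    | succ i ih => rw [pow_succ_apply, ih, hz]
  rw [reynolds_def, reynolds_def, Finset.mul_sum]
  exact Finset.sum_congr rfl fun i _ => by rw [map_mul, hzi]; ring

/-- The Reynolds operator of an honest monomial: `P_χ x^a = (∑ᵢ ζ^{i((ℓ-1)χ + wt a)}) x^a`, i.e. `ℓ x^a`
if `wt a ≡ χ (mod ℓ)` and `0` otherwise. [folklore] -/
theorem reynolds_prod_pow (σ : L ≃ₐ[k] L) (x : ι → L) {ζ : k} {ℓ : ℕ} (hζ : IsPrimitiveRoot ζ ℓ)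
    (hℓ : 0 < ℓ) (t : ι → ℕ) (heig : ∀ j, σ (x j) = algebraMap k L (ζ ^ t j) * x j)
    (a : ι →₀ ℕ) (χ : ℕ) :
    reynolds σ (ζ ^ (ℓ - 1)) ℓ χ (∏ j, x j ^ a j) =
      (if ℓ ∣ (ℓ - 1) * χ + ∑ j, a j * t j then (ℓ : L) else 0) * ∏ j, x j ^ a j := by
  rw [reynolds_eq_mul_of_iterates σ (ζ ^ (ℓ - 1)) ℓ χ
    (fun i => algebraMap k L (ζ ^ (i * ∑ j, a j * t j)))
    (fun i _ => pow_sigma_prod_pow σ x t heig a i)]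
  congr 1
  have : ∀ i ∈ Finset.range ℓ, algebraMap k L ((ζ ^ (ℓ - 1)) ^ (χ * i)) *
      algebraMap k L (ζ ^ (i * ∑ j, a j * t j)) =
      algebraMap k L (ζ ^ (i * ((ℓ - 1) * χ + ∑ j, a j * t j))) := fun i _ => by
    rw [← map_mul, ← pow_mul, ← pow_add]
    congr 2
    ring
  rw [Finset.sum_congr rfl this, ← map_sum, sum_pow_mul_eq_ite hζ hℓ]
  split_ifs <;> simp

/-- The `χ`-isotypic part of the value of a polynomial at `x`, as an element of `L`:
`S_χ P = Σ_{a ∈ supp P, wt a ≡ χ} coeff_a P · x^a`. [folklore] -/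
noncomputable def isoPart (x : ι → L) (ℓ : ℕ) (t : ι → ℕ) (χ : ℕ) (P : MvPolynomial ι k) : L :=
  ∑ a ∈ P.support.filter (fun a => ℓ ∣ (ℓ - 1) * χ + ∑ j, a j * t j),
    algebraMap k L (P.coeff a) * ∏ j, x j ^ a j

/-- `aeval_eq_sum`: Bookkeeping / simp lemma of the eigen-ladder kernel (decomp-res lens-1 g24 «EigenLadder»),
VERBATIM from the lens's tree file (see the module docstring); the statement is its type. [folklore] -/
theorem aeval_eq_sum (x : ι → L) (P : MvPolynomial ι k) :
    MvPolynomial.aeval x P = ∑ a ∈ P.support, algebraMap k L (P.coeff a) * ∏ j, x j ^ a j := by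
  rw [MvPolynomial.aeval_def, MvPolynomial.eval₂_eq']

/-- **Reynolds projects onto the isotypic part**: `P_χ (P(x)) = ℓ · S_χ P`. [folklore] -/
theorem reynolds_aeval (σ : L ≃ₐ[k] L) (x : ι → L) {ζ : k} {ℓ : ℕ} (hζ : IsPrimitiveRoot ζ ℓ)
    (hℓ : 0 < ℓ) (t : ι → ℕ) (heig : ∀ j, σ (x j) = algebraMap k L (ζ ^ t j) * x j)
    (P : MvPolynomial ι k) (χ : ℕ) :
    reynolds σ (ζ ^ (ℓ - 1)) ℓ χ (MvPolynomial.aeval x P) = (ℓ : L) * isoPart x ℓ t χ P := by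
  rw [aeval_eq_sum, reynolds_sum, isoPart, Finset.mul_sum, Finset.sum_filter]
  refine Finset.sum_congr rfl fun a _ => ?_
  rw [reynolds_mul_of_fixed σ _ ℓ χ (σ.commutes (P.coeff a)), reynolds_prod_pow σ x hζ hℓ t heig a χ]
  split_ifs <;> ring

/-- **Invariants lie in the field of invariant Laurent monomials.**  Let `σ` act diagonally on
`x : ι → L` with characters `ζ^{tⱼ}` (`ζ` a primitive `ℓ`-th root of unity in `k`, `(ℓ : k) ≠ 0`,
`σ^ℓ = 1`), and let `F ⊆ L` be a subfield containing `k` and every Laurent monomial `x^b` with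
`ℓ ∣ ⟨b, t⟩`.  Then every `σ`-INVARIANT element of `k(x)` lies in `F`.  PROOF: write `z = P(x)/Q(x)`;
some isotypic part `P_χ Q(x) = ℓ S_χ Q ≠ 0` (`Σ_χ P_χ = ℓ · id`); as `z` is invariant,
`P_χ P(x) = z · P_χ Q(x)`, so `z = S_χ P / S_χ Q`; dividing numerator and denominator by one monomial
`x^{a₀}` of `S_χ Q` exhibits both as sums of monomials of the character lattice. [CossartPiltant2008,
Prop. 6.2] [folklore] -/
theorem mem_of_fixed_aux (σ : L ≃ₐ[k] L) {ℓ : ℕ} (hℓ : 0 < ℓ) (hℓk : (ℓ : k) ≠ 0)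
    {ζ : k} (hζ : IsPrimitiveRoot ζ ℓ) (x : ι → L) (hx0 : ∀ j, x j ≠ 0) (t : ι → ℕ)
    (heig : ∀ j, σ (x j) = algebraMap k L (ζ ^ t j) * x j) (F : Subfield L)
    (hkF : ∀ c : k, algebraMap k L c ∈ F)
    (hMF : ∀ b : ι → ℤ, (ℓ : ℤ) ∣ ∑ j, b j * (t j : ℤ) → lmon x b ∈ F)
    (P Q : MvPolynomial ι k) (hQ0 : MvPolynomial.aeval x Q ≠ 0) {z : L}
    (hPz : MvPolynomial.aeval x P = z * MvPolynomial.aeval x Q) (hσz : σ z = z) : z ∈ F := by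
  have hζ' : IsPrimitiveRoot (ζ ^ (ℓ - 1)) ℓ :=
    hζ.pow_of_coprime (ℓ - 1) ((Nat.coprime_self_sub_left hℓ).mpr (Nat.coprime_one_left ℓ))
  -- some isotypic part of `Q(x)` is non-zero
  have hsumQ := sum_reynolds σ hℓ hζ' (MvPolynomial.aeval x Q)
  have hℓL : (ℓ : L) ≠ 0 := by
    rw [← map_natCast (algebraMap k L)]
    exact (map_ne_zero _).mpr hℓk
  obtain ⟨χ, -, hχ⟩ : ∃ χ ∈ Finset.range ℓ,
      reynolds σ (ζ ^ (ℓ - 1)) ℓ χ (MvPolynomial.aeval x Q) ≠ 0 := by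
    apply Finset.exists_ne_zero_of_sum_ne_zero
    rw [hsumQ]
    exact mul_ne_zero hℓL hQ0
  have hRP : reynolds σ (ζ ^ (ℓ - 1)) ℓ χ (MvPolynomial.aeval x P) =
      z * reynolds σ (ζ ^ (ℓ - 1)) ℓ χ (MvPolynomial.aeval x Q) := by
    rw [hPz, reynolds_mul_of_fixed σ _ ℓ χ hσz]
  rw [reynolds_aeval σ x hζ hℓ t heig Q χ] at hχ hRP
  rw [reynolds_aeval σ x hζ hℓ t heig P χ, ← mul_assoc, mul_comm z, mul_assoc] at hRP
  have hSQ : isoPart x ℓ t χ Q ≠ 0 := fun h => hχ (by rw [h, mul_zero])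
  -- `z = S_χ P / S_χ Q`
  have hzS : z = isoPart x ℓ t χ P / isoPart x ℓ t χ Q := by
    rw [eq_div_iff hSQ]
    exact (mul_left_cancel₀ hℓL hRP).symm
  -- a monomial `x^{a₀}` of `S_χ Q`
  obtain ⟨a₀, ha₀, -⟩ : ∃ a₀ ∈ Q.support.filter (fun a => ℓ ∣ (ℓ - 1) * χ + ∑ j, a j * t j),
      algebraMap k L (Q.coeff a₀) * ∏ j, x j ^ a₀ j ≠ 0 := by
    unfold isoPart at hSQ
    exact Finset.exists_ne_zero_of_sum_ne_zero hSQ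
  have ha₀dvd : ℓ ∣ (ℓ - 1) * χ + ∑ j, a₀ j * t j := (Finset.mem_filter.mp ha₀).2
  have hm0 : (∏ j, x j ^ a₀ j) ≠ 0 := Finset.prod_ne_zero_iff.mpr fun j _ => pow_ne_zero _ (hx0 j)
  -- every monomial of an isotypic part, divided by `x^{a₀}`, is a lattice monomial
  have hmon : ∀ a : ι →₀ ℕ, ℓ ∣ (ℓ - 1) * χ + ∑ j, a j * t j →
      (∏ j, x j ^ a j) * (∏ j, x j ^ a₀ j)⁻¹ ∈ F := by
    intro a ha
    have heq : (∏ j, x j ^ a j) * (∏ j, x j ^ a₀ j)⁻¹ =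
        lmon x (fun j => (a j : ℤ) - (a₀ j : ℤ)) := by
      have h1 : (fun j => (a j : ℤ) - (a₀ j : ℤ)) = (fun j => (a j : ℤ)) - fun j => (a₀ j : ℤ) := rfl
      rw [h1, lmon_sub x hx0, lmon_natCast, lmon_natCast]
    rw [heq]
    apply hMF
    have hsum : ∑ j, ((a j : ℤ) - (a₀ j : ℤ)) * (t j : ℤ) =
        (((ℓ - 1) * χ + ∑ j, a j * t j : ℕ) : ℤ) - (((ℓ - 1) * χ + ∑ j, a₀ j * t j : ℕ) : ℤ) := by
      push_cast
      simp only [sub_mul, Finset.sum_sub_distrib]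
      ring
    rw [hsum]
    exact dvd_sub (Int.natCast_dvd_natCast.mpr ha) (Int.natCast_dvd_natCast.mpr ha₀dvd)
  have hiso : ∀ R : MvPolynomial ι k, isoPart x ℓ t χ R * (∏ j, x j ^ a₀ j)⁻¹ ∈ F := by
    intro R
    rw [isoPart, Finset.sum_mul]
    refine Subfield.sum_mem _ fun a ha => ?_
    rw [mul_assoc]
    exact F.mul_mem (hkF _) (hmon a (Finset.mem_filter.mp ha).2)
  have hfinal : z = (isoPart x ℓ t χ P * (∏ j, x j ^ a₀ j)⁻¹) /
      (isoPart x ℓ t χ Q * (∏ j, x j ^ a₀ j)⁻¹) := by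
    rw [mul_div_mul_right _ _ (inv_ne_zero hm0)]
    exact hzS
  rw [hfinal]
  exact F.div_mem (hiso P) (hiso Q)

/-- **Invariants lie in the field of invariant Laurent monomials.**  Let `σ` act diagonally on
`x : ι → L` with characters `ζ^{tⱼ}` (`ζ` a primitive `ℓ`-th root of unity in `k`, `(ℓ : k) ≠ 0`),
and let `F ⊆ L` be a subfield containing `k` and every Laurent monomial `x^b` with `ℓ ∣ ⟨b, t⟩`.  Then
every `σ`-INVARIANT element of `k(x)` lies in `F`.  PROOF: write `z = P(x)/Q(x)`; some isotypic part
`P_χ Q(x) = ℓ S_χ Q ≠ 0` (`Σ_χ P_χ = ℓ · id`); as `z` is invariant, `P_χ P(x) = z · P_χ Q(x)`, so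
`z = S_χ P / S_χ Q`; dividing numerator and denominator by one monomial `x^{a₀}` of `S_χ Q` exhibits
both as sums of monomials of the character lattice. [CossartPiltant2008, Prop. 6.2] [folklore] -/
theorem mem_of_fixed (σ : L ≃ₐ[k] L) {ℓ : ℕ} (hℓ : 0 < ℓ) (hℓk : (ℓ : k) ≠ 0)
    {ζ : k} (hζ : IsPrimitiveRoot ζ ℓ) (x : ι → L) (hx0 : ∀ j, x j ≠ 0) (t : ι → ℕ)
    (heig : ∀ j, σ (x j) = algebraMap k L (ζ ^ t j) * x j) (F : Subfield L)
    (hkF : ∀ c : k, algebraMap k L c ∈ F)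
    (hMF : ∀ b : ι → ℤ, (ℓ : ℤ) ∣ ∑ j, b j * (t j : ℤ) → lmon x b ∈ F)
    {z : L} (hz : z ∈ IntermediateField.adjoin k (Set.range x)) (hσz : σ z = z) : z ∈ F := by
  rw [IntermediateField.mem_adjoin_iff_div] at hz
  obtain ⟨f, hf, g, hg, hfg⟩ := hz
  rw [Algebra.adjoin_range_eq_range_aeval] at hf hg
  obtain ⟨P, hP⟩ := hf
  obtain ⟨Q, hQ⟩ := hg
  have hP' : MvPolynomial.aeval x P = f := hP
  have hQ' : MvPolynomial.aeval x Q = g := hQ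
  by_cases hg0 : g = 0
  · rw [hfg, hg0, div_zero]
    exact F.zero_mem
  refine mem_of_fixed_aux σ hℓ hℓk hζ x hx0 t heig F hkF hMF P Q (by rwa [hQ']) (z := z) ?_ hσz
  rw [hP', hQ', hfg, div_mul_cancel₀ _ hg0]

end Invariants

end Summit.ResolutionOfSingularities.ResolutionOfSingularities.Theorems.EigenLadderLU
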